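import Summits.BirchSwinnertonDyer.Rank1Residual.X5.TwoAdicTargetsSplitAuto
import Summits.BirchSwinnertonDyer.Rank1Residual.X5.TwoAdicTargetsMultKatoRat
import Summits.BirchSwinnertonDyer.Rank1Residual.X5.TwoAdicTargetsCalibMult
import Literature.NumberTheory.EllipticCurves.PAdicHeightsLogProofs
import Literature.NumberTheory.EllipticCurves.PAdicHeightsLInvariantHoldsProofs
import Literature.NumberTheory.EllipticCurves.PAdicLFunctionIntegralityAtTwoProofs
import HarnessLib

/-!
# Class O1 (X5, `p = 2`, non-CM): the `κ₁`-certificate of the split-`2` END doors DISCHARGED by the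
# Greenberg–Stevens formula at `2`, and the rank-`0` calibration of `TwoAdicBSDSplitMult`

HONEST FRAMING (cell `bsd-2adic`, run/shared/lean/pub/bsd-2adic/, FULL-BSD rank ≤ 1 programme
tranche 1b, D-0036; seat `bsd-2adic-mult`, GEN 2): research routes; no claim beyond the stated
classes; nothing here is booked; no mark of RESIDUAL-MAP §I moves. Theorems only: 0 typed targets,
0 new named facts. The ONE research input of this file is the tree's EXISTING named fact
`greenberg_stevens W 2` (`Literature/…/PAdicBSD.lean`: `L₂(E,0) = 0` and
`[T¹]L₂(E,T) · log₂ γ = 𝓛₂(E) · [0]⁺_f` at a split multiplicative `2`; its docstring flags that NO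
printed proof of the instance `p = 2` had been located — Greenberg–Stevens 1993 `p ≥ 5`, Kobayashi
2006 `p` odd, Colmez 2004 fn. 8). The seat's memo `HOME/mult/PROOF-GS2.md` PROVES that instance
(Kobayashi's Coleman-map argument run at `p = 2`: `Δ = {±1}`, the Honda-type logarithm
`ℓ₂(X) = log(1+X) + Σ_k 2^{-k} Σ_{δ=±1} ((1+X)^{2^k δ} - 1)`, an invariant Hilbert-90 over `Λ ⊗ ℚ`,
and Coleman's interpolation theorem — de Shalit 1987 Thm. I.2.2, any `p` — for the constant
`e = 8/log₂ 5` in the memo's squared normalisation of the units) — cell referee RC-4 **PASS** (HOME/REFEREE.md §5,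
2026-08-25T16:11Z); until that PASS is converted by the operator, `greenberg_stevens W 2` stays a
displayed hypothesis here exactly as before — but it now REPLACES the per-curve `κ₁`-certificate.

* `valuation_padicLog_cyclotomicGenerator_two` (PROVED): `ord₂ log₂ γ = ord₂ log₂ 5 = 2`
  (`‖log₂ y‖ = ‖1 - y‖` on `1 + 4ℤ₂`, tree theorem `norm_padicLogSeries_eq`).
* **`kappaOne_of_greenbergStevens` (PROVED)**: `greenberg_stevens W 2` + `r_an = 0` ⇒ the
  `κ₁`-certificate `hκ₁` of `X5/TwoAdicTargetsSplitEndAlpha.lean` for EVERY newform `f` of `W`, every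
  `L` with `IsSplitMultPAdicLFunctionOf f 2 L` and every Tate datum: `c₁ ≠ 0` and
  `ord₂ c₁ ≤ ord₂ [0]⁺_f + (ord₂ 𝓛₂(E) - 2)` — with EQUALITY (`c₁ = 𝓛₂(E)·[0]⁺_f / log₂ 5`,
  `[0]⁺_f ≠ 0` from `r_an = 0`, `𝓛₂(E) ≠ 0` by Barré-Sirieix–Diaz–Gramain–Philibert).
* The two split-`2` END doors of `X5/TwoAdicTargetsSplitAuto.lean` with `hκ₁` DISCHARGED (PROVED):
  `bsdp_two_split_of_prop514_of_lowerBound_of_greenbergStevens`,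
  `bsdp_two_split_of_mu_eq_zero_of_lowerBound_of_greenbergStevens`: per pair `BSDp W 2` ⟸ PRINT
  {Prop. 5.14 at `2` / a `μ = 0` certificate, Greenberg's split display A236, modularity, GZK} +
  K11b-Rat `hK` (Kato `⊗ℚ` at a split `2`; the seat's `HOME/mult/PROOF-MULT.md` Thm. B, referee
  pending; equivalently the prime-uniform binder of `X5/TwoAdicTargetsMultKatoRat.lean`) +
  `greenberg_stevens W 2` + DATA {`hper₀`} + `hlow`. On this road the ONLY per-pair inputs left at a
  split `2` in analytic rank `0` are the period datum `hper₀` and the lower half `hlow`.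
* (appended, GEN 2 second pass) `bsdp_two_split_of_{prop514,mu_eq_zero}_of_lowerBound_of_multRat_of_greenbergStevens`
  (PROVED): the same two doors with `hK` fed by the prime-uniform binder
  `KatoMultiplicativeDivisibilityRat W 2` of `X5/TwoAdicTargetsMultKatoRat.lean` — per pair `BSDp W 2` ⟸
  PRINT + the two memo-proved binders (PROOF-MULT, PROOF-GS2) + `hper₀` + `hlow`.
* **CALIBRATION (PROVED): `twoAdicBSDSplitMult_iff_of_rankZero`** — at a split multiplicative `2`
  with `rank E(ℚ) = 0 = r_an`, GIVEN `greenberg_stevens W 2`, the E1 target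
  `O1.TwoAdicBSDSplitMult W D` (`= PAdicBSDConjectureExceptional W 2 D`, MTT's exceptional-zero
  `2`-adic BSD) holds for a height datum `D` IFF (`Ш` finite ⇒ `#Ш_an = #Ш`); with GZK,
  `twoAdicBSDSplitMult_iff_shaAn_eq_of_analyticRank_eq_zero`. The split twin of
  `X5/TwoAdicTargetsCalibMult.lean`.

References: [GreenbergStevens1993] Thm. of the Introduction (p ≥ 5); [Kobayashi2006DocMath] Thm. 4.1,
Cor. 4.2 (odd p); [MazurTateTeitelbaum1986Invent] §I.10, §I.14, §II.10; [deShalit1987] Thm. I.2.2;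
[GreenbergLNM1716] Prop. 5.14, §4 pp. 112–113; [BarreSirieixDiazGramainPhilibert1996Manin] Thm. 1;
[Miller2011LMS] Def. 1.1.
-/

set_option autoImplicit false

noncomputable section

open scoped Classical MatrixGroups ModularForm

open CongruenceSubgroup WeierstrassCurve Literature.NumberTheory.EllipticCurves
  Literature.NumberTheory.EllipticCurves.ModularForms
  Literature.NumberTheory.EllipticCurves.Greenberg1999
  Literature.NumberTheory.EllipticCurves.Rank1Residual
  Literature.NumberTheory.EllipticCurves.Rank1Residual.Typed

namespace Summit.BirchSwinnertonDyer.Rank1Residual.X5.O1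

variable (W : WeierstrassCurve ℚ) [W.IsElliptic] [W.IsGloballyMinimal]

/-! ## §1 `ord₂ log₂ γ = 2` -/

/-- **`ord₂ log₂ 5 = 2`.** The cyclotomic variable at `2` is `γ = 5 = 1 + 2²`
(`cyclotomicGenerator_two`); on `1 + 4ℤ₂` the `2`-adic logarithm is an isometry
(`norm_padicLogSeries_eq`: `‖log₂ y‖ = ‖1 - y‖` for `‖1 - y‖ < ‖2‖`), so `‖log₂ 5‖ = ‖-4‖ = 2⁻²`.
[cite: Iwasawa1972PadicL, §4.4] -/
theorem valuation_padicLog_cyclotomicGenerator_two :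
    (padicLog 2 ((cyclotomicGenerator 2 : ℕ) : ℚ_[2])).valuation = 2 := by
  have h5 : ((cyclotomicGenerator 2 : ℕ) : ℚ_[2]) = 5 := by
    rw [cyclotomicGenerator_two]; norm_num
  rw [h5]
  have h14 : (1 : ℚ_[2]) - 5 = -((2 : ℚ_[2]) ^ 2) := by norm_num
  have hnorm14 : ‖(1 : ℚ_[2]) - 5‖ = (2 : ℝ) ^ (-(2 : ℤ)) := by
    rw [h14, norm_neg]
    have := Padic.norm_p_pow (p := 2) 2
    exact_mod_cast this
  have h2 : ‖(2 : ℚ_[2])‖ = (2 : ℝ)⁻¹ := by exact_mod_cast Padic.norm_p (p := 2)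
  have hlt2 : ‖(1 : ℚ_[2]) - 5‖ < ‖(2 : ℚ_[2])‖ := by
    rw [hnorm14, h2]; norm_num
  have hlt1 : ‖(1 : ℚ_[2]) - 5‖ < 1 := by rw [hnorm14]; norm_num
  rw [padicLog_eq_padicLogSeries hlt1]
  have hn : ‖padicLogSeries 2 (5 : ℚ_[2])‖ = (2 : ℝ) ^ (-(2 : ℤ)) := by
    rw [norm_padicLogSeries_eq hlt2, hnorm14]
  have hne : padicLogSeries 2 (5 : ℚ_[2]) ≠ 0 := by
    intro h0; rw [h0, norm_zero] at hn; exact absurd hn (by positivity)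
  exact valuation_eq_of_norm_eq hne (by exact_mod_cast hn)

/-- `log₂ γ ≠ 0` (from `ord₂ log₂ γ = 2`, i.e. `‖log₂ 5‖ = 1/4`). [cite: Iwasawa1972PadicL, §4.4] -/
theorem padicLog_cyclotomicGenerator_two_ne_zero :
    padicLog 2 ((cyclotomicGenerator 2 : ℕ) : ℚ_[2]) ≠ 0 := by
  intro h0
  have h := valuation_padicLog_cyclotomicGenerator_two
  rw [h0, Padic.valuation_zero] at h
  exact absurd h (by norm_num)

/-! ## §2 The `κ₁`-certificate from the Greenberg–Stevens formula at `2` -/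

omit [W.IsGloballyMinimal] in
/-- `𝓛₂(E) ≠ 0` for every Tate datum (Barré-Sirieix–Diaz–Gramain–Philibert: `log₂ q_E ≠ 0`, tree
theorem `LInvariant_ne_zero_holds`). [cite: BarreSirieixDiazGramainPhilibert1996Manin, Thm. 1, Cor.] -/
theorem lInvariant_two_ne_zero (Dq : TateParameterData W 2) : LInvariant Dq ≠ 0 :=
  LInvariant_ne_zero_holds (W := W) (p := 2) Dq

omit [W.IsGloballyMinimal] in
/-- **The `κ₁`-certificate from Greenberg–Stevens at `2` (PROVED).** If `greenberg_stevens W 2`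
(`c₁ · log₂ γ = 𝓛₂(E) · [0]⁺_f` for every newform `f` of `W`, every split `2`-adic `L`-function
`L` of `f` and every Tate datum) and `r_an(E) = 0`, then `c₁ = [T¹]L ≠ 0` and
`ord₂ c₁ ≤ ord₂ [0]⁺_f + (ord₂ 𝓛₂(E) - 2)` — in fact with equality: `c₁ = 𝓛₂(E)·[0]⁺_f/log₂ 5`,
`[0]⁺_f ≠ 0` (`r_an = 0`), `𝓛₂(E) ≠ 0`, `ord₂ log₂ 5 = 2`. This is verbatim the hypothesis `hκ₁` of
`X5/TwoAdicTargetsSplitEndAlpha.lean` / `X5/TwoAdicTargetsSplitAuto.lean`.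
[cite: Kobayashi2006DocMath, Cor. 4.2 (p. 575; shape, odd p)] [cite: MazurTateTeitelbaum1986Invent, §II.10] -/
theorem kappaOne_of_greenbergStevens (hGS : greenberg_stevens (W := W) (p := 2))
    (hr : W.analyticRank = 0) {N : ℕ} [NeZero N] {f : CuspForm (Gamma0 N) 2}
    (hf : IsNewformOf W f) {L : PowerSeries ℚ_[2]} (hL : IsSplitMultPAdicLFunctionOf f 2 L)
    (Dq : TateParameterData W 2) :
    PowerSeries.coeff 1 L ≠ 0 ∧ (PowerSeries.coeff 1 L).valuation ≤
      padicValRat 2 (ratPlusSymbol f 0) + ((LInvariant Dq).valuation - 2) := by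
  obtain ⟨-, hGS1⟩ := hGS Dq hf hL
  have hlog0 := padicLog_cyclotomicGenerator_two_ne_zero
  have hs0 : (ratPlusSymbol f 0 : ℚ_[2]) ≠ 0 := by
    have hL1 : W.entireLFunction 1 ≠ 0 :=
      (W.analyticRank_eq_zero_iff_holds hf.hasEntireLFunction).mp hr
    exact_mod_cast (ratPlusSymbol_zero_ne_zero_iff W hf).mpr hL1
  have hLI0 := lInvariant_two_ne_zero W Dq
  have hc : PowerSeries.coeff 1 L =
      LInvariant Dq * (ratPlusSymbol f 0 : ℚ_[2]) *
        (padicLog 2 ((cyclotomicGenerator 2 : ℕ) : ℚ_[2]))⁻¹ := by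
    rw [← hGS1, mul_inv_cancel_right₀ hlog0]
  have hc0 : PowerSeries.coeff 1 L ≠ 0 := by
    rw [hc]; exact mul_ne_zero (mul_ne_zero hLI0 hs0) (inv_ne_zero hlog0)
  refine ⟨hc0, le_of_eq ?_⟩
  rw [hc, Padic.valuation_mul (mul_ne_zero hLI0 hs0) (inv_ne_zero hlog0),
    Padic.valuation_mul hLI0 hs0, Padic.valuation_inv, Padic.valuation_ratCast,
    valuation_padicLog_cyclotomicGenerator_two]
  ring

omit [W.IsGloballyMinimal] in
/-- The `κ₁`-certificate in the exact binder shape of the split END doors (newform at level `N_E`).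
[cite: MazurTateTeitelbaum1986Invent, §II.10] -/
theorem kappaOne_binder_of_greenbergStevens (hGS : greenberg_stevens (W := W) (p := 2))
    (hr : W.analyticRank = 0) :
    ∀ [NeZero (W.conductorNorm ℤ)] (f : CuspForm (Gamma0 (W.conductorNorm ℤ)) 2),
      IsNewformOf W f → ∀ L : PowerSeries ℚ_[2], IsSplitMultPAdicLFunctionOf f 2 L →
      ∀ Dq : TateParameterData W 2, PowerSeries.coeff 1 L ≠ 0 ∧
        (PowerSeries.coeff 1 L).valuation ≤
          padicValRat 2 (ratPlusSymbol f 0) + ((LInvariant Dq).valuation - 2) :=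
  fun _ hf _ hL Dq => kappaOne_of_greenbergStevens W hGS hr hf hL Dq

/-! ## §3 The split-`2` END doors with `hκ₁` discharged -/

/-- **α-sp END-STATE per pair, `κ₁` DISCHARGED by Greenberg–Stevens at `2` (PROVED):** split
multiplicative `2`, analytic rank `0`, Prop. 5.14 locus: `BSDp W 2` ⟸ PRINT {`h514`, A236 `h41`,
modularity, GZK} + K11b-Rat `hK` + `greenberg_stevens W 2` + the 5.14 data + `hper₀` + `hlow`
(`bsdp_two_split_of_prop514_of_lowerBound_auto` with `hκ₁ := kappaOne_binder_of_greenbergStevens`).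
[cite: GreenbergLNM1716, Prop. 5.14 (p. 121) and §4 pp. 112–113] [cite: Miller2011LMS, Def. 1.1 and §1] -/
theorem bsdp_two_split_of_prop514_of_lowerBound_of_greenbergStevens
    (hGS : greenberg_stevens (W := W) (p := 2))
    (h514 : prop514_isTorsion_mu_eq_zero_two)
    (h41 : thm41Analogue_charValue_rankZero_split_baseChange_anyPrime)
    (hmod : nonempty_modularParametrizationData)
    (hGZK : rank_eq_analyticRank_of_analyticRank_le_one)
    (hK : ∀ [NeZero (W.conductorNorm ℤ)] (f : CuspForm (Gamma0 (W.conductorNorm ℤ)) 2)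
      (L : PowerSeries ℚ_[2]), KatoDivisibilityAtTwoSplitMultRat W f L)
    (hper₀ : ∀ [NeZero (W.conductorNorm ℤ)] (f : CuspForm (Gamma0 (W.conductorNorm ℤ)) 2),
      IsNewformOf W f → ∀ ϖ : ℚ, (ϖ : ℝ) * W.realPeriodRat = plusPeriod f → 0 ≤ padicValRat 2 ϖ)
    (hr : W.analyticRank = 0) (hmult : Mult W 2) (hsp : W.HasSplitMultiplicativeReductionAtPrime 2)
    {x y : ℚ} (hP : W.toAffine.Equation x y) (h2 : 2 * y + W.a₁ * x + W.a₃ = 0)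
    (hΦ : (TwoTorsionRamifiedAtTwo x ∧ ¬ TwoTorsionOdd W x) ∨
      (TwoTorsionOdd W x ∧ ¬ TwoTorsionRamifiedAtTwo x))
    (hlow : MissingLowerBoundAt W 2) : BSDp W 2 :=
  bsdp_two_split_of_prop514_of_lowerBound_auto W h514 h41 hmod hGZK hK
    (kappaOne_binder_of_greenbergStevens W hGS hr) hper₀ hr hmult hsp hP h2 hΦ hlow

/-- **O1-A-sp END-STATE per pair from a `μ = 0` certificate, `κ₁` DISCHARGED by Greenberg–Stevens at
`2` (PROVED):** `BSDp W 2` ⟸ PRINT {A236 `h41`, modularity, GZK} + K11b-Rat `hK` +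
`greenberg_stevens W 2` + `hμ` + `hper₀` + `hlow`.
[cite: GreenbergLNM1716, §4 pp. 112–113] [cite: Miller2011LMS, Def. 1.1 and §1] -/
theorem bsdp_two_split_of_mu_eq_zero_of_lowerBound_of_greenbergStevens
    (hGS : greenberg_stevens (W := W) (p := 2))
    (h41 : thm41Analogue_charValue_rankZero_split_baseChange_anyPrime)
    (hmod : nonempty_modularParametrizationData)
    (hGZK : rank_eq_analyticRank_of_analyticRank_le_one)
    (hK : ∀ [NeZero (W.conductorNorm ℤ)] (f : CuspForm (Gamma0 (W.conductorNorm ℤ)) 2)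
      (L : PowerSeries ℚ_[2]), KatoDivisibilityAtTwoSplitMultRat W f L)
    (hμ : ∀ (κ : ZpExtension ℚ 2) (γ : Field.absoluteGaloisGroup ℚ), κ.IsCyclotomic →
      κ.IsTopGenerator γ → IsCyclotomicVariable 2 γ → ∀ D : W.SelmerDualData κ γ, D.mu = 0)
    (hper₀ : ∀ [NeZero (W.conductorNorm ℤ)] (f : CuspForm (Gamma0 (W.conductorNorm ℤ)) 2),
      IsNewformOf W f → ∀ ϖ : ℚ, (ϖ : ℝ) * W.realPeriodRat = plusPeriod f → 0 ≤ padicValRat 2 ϖ)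
    (hr : W.analyticRank = 0) (hmult : Mult W 2) (hsp : W.HasSplitMultiplicativeReductionAtPrime 2)
    (hlow : MissingLowerBoundAt W 2) : BSDp W 2 :=
  bsdp_two_split_of_mu_eq_zero_of_lowerBound_auto W h41 hmod hGZK hK hμ
    (kappaOne_binder_of_greenbergStevens W hGS hr) hper₀ hr hmult hsp hlow

/-! ## §4 CALIBRATION of the E1 split target `TwoAdicBSDSplitMult` in rank `0` -/

omit [W.IsGloballyMinimal] in
/-- **Clause (i) at a split `2` in rank `0`, given Greenberg–Stevens at `2`**: for `L` with
`IsSplitMultPAdicLFunctionOf f 2 L`, `ord_{T=0} L = 1` when `r_an = 0` (`L(0) = 0` is the trivial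
zero; `c₁ ≠ 0` by `kappaOne_of_greenbergStevens`). [cite: MazurTateTeitelbaum1986Invent, §II.10]
[cite: Kobayashi2006DocMath, Cor. 4.2 (shape, odd p)] -/
theorem order_eq_one_of_greenbergStevens_of_analyticRank_eq_zero
    (hGS : greenberg_stevens (W := W) (p := 2)) (hr : W.analyticRank = 0) {N : ℕ} [NeZero N]
    {f : CuspForm (Gamma0 N) 2} (hf : IsNewformOf W f) {L : PowerSeries ℚ_[2]}
    (hL : IsSplitMultPAdicLFunctionOf f 2 L) (Dq : TateParameterData W 2) : L.order = 1 := by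
  have h1 : ((1 : ℕ) : ℕ∞) = 1 := Nat.cast_one
  rw [← h1, PowerSeries.order_eq_nat]
  refine ⟨(kappaOne_of_greenbergStevens W hGS hr hf hL Dq).1, fun i hi => ?_⟩
  have hi0 : i = 0 := by omega
  subst hi0
  rw [PowerSeries.coeff_zero_eq_constantCoeff]
  exact hL.constantCoeff_eq_zero

omit [W.IsGloballyMinimal] in
/-- **Clause (ii) at a split `2` in rank `0`, given Greenberg–Stevens at `2`,** is the rational
identity `ϖ·[0]⁺_f·#tors² = #Ш·∏c` (cancel `𝓛₂(E) ≠ 0`; `c₁·log₂ γ = 𝓛₂(E)·[0]⁺_f`; `Reg₂(D) = 1`).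
[cite: MazurTateTeitelbaum1986Invent, §II.10] -/
theorem twoAdicLeadingTermSplit_iff_of_rankZero (hGS : greenberg_stevens (W := W) (p := 2))
    (hr : W.mordellWeilRank = 0) {N : ℕ} [NeZero N] {f : CuspForm (Gamma0 N) 2}
    (hf : IsNewformOf W f) {L : PowerSeries ℚ_[2]} (hL : IsSplitMultPAdicLFunctionOf f 2 L)
    (Dq : TateParameterData W 2) (D : PAdicHeightData W 2) (ϖ : ℚ) :
    ((ϖ : ℚ_[2]) * PowerSeries.coeff (W.mordellWeilRank + 1) L *
          padicLog 2 (cyclotomicGenerator 2) ^ (W.mordellWeilRank + 1) * (W.torsionOrder : ℚ_[2]) ^ 2 =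
        LInvariant Dq * (W.shaOrder * padicRegulator D * W.tamagawaProduct)) ↔
      ϖ * ratPlusSymbol f 0 * (W.torsionOrder : ℚ) ^ 2 = W.shaOrder * W.tamagawaProduct := by
  obtain ⟨-, hGS1⟩ := hGS Dq hf hL
  have hLI0 := lInvariant_two_ne_zero W Dq
  rw [hr, zero_add, pow_one, padicRegulator_eq_one_of_mordellWeilRank_eq_zero W 2 hr D, mul_one]
  have key : (ϖ : ℚ_[2]) * PowerSeries.coeff 1 L * padicLog 2 (cyclotomicGenerator 2) *
        (W.torsionOrder : ℚ_[2]) ^ 2 =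
      LInvariant Dq * ((ϖ : ℚ_[2]) * (ratPlusSymbol f 0 : ℚ_[2]) * (W.torsionOrder : ℚ_[2]) ^ 2) := by
    have : (ϖ : ℚ_[2]) * PowerSeries.coeff 1 L * padicLog 2 (cyclotomicGenerator 2) =
        (ϖ : ℚ_[2]) * (PowerSeries.coeff 1 L * padicLog 2 (cyclotomicGenerator 2)) := by ring
    rw [this, hGS1]; ring
  rw [key]
  constructor
  · intro h
    have h'' := mul_left_cancel₀ hLI0 h
    exact_mod_cast h''
  · intro h
    have h' : (ϖ : ℚ_[2]) * (ratPlusSymbol f 0 : ℚ_[2]) * (W.torsionOrder : ℚ_[2]) ^ 2 =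
        (W.shaOrder : ℚ_[2]) * (W.tamagawaProduct : ℚ_[2]) := by exact_mod_cast h
    rw [h']

/-- **`TwoAdicBSDSplitMult ⟹ #Ш = #Ш_an` in rank `0`, given Greenberg–Stevens at `2`** (split
multiplicative `2`, `rank E(ℚ) = 0 = r_an`; a Tate datum and the split `2`-adic `L`-function EXIST:
`nonempty_tateParameterData_iff_holds`, `exists_isSplitMultPAdicLFunctionOf`).
[cite: MazurTateTeitelbaum1986Invent, §II.10] [cite: SilvermanATAEC1994, Thm. V.5.3] -/
theorem shaAn_eq_shaOrder_of_twoAdicBSDSplitMult_of_rankZero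
    (hGS : greenberg_stevens (W := W) (p := 2))
    (hsp : W.HasSplitMultiplicativeReductionAtPrime 2) (hr : W.mordellWeilRank = 0)
    (han : W.analyticRank = 0) {N : ℕ} [NeZero N] {f : CuspForm (Gamma0 N) 2}
    (hf : IsNewformOf W f) (ϖ : ℚ) (hϖ : (ϖ : ℝ) * W.realPeriodRat = plusPeriod f)
    {D : PAdicHeightData W 2} (h : TwoAdicBSDSplitMult W D) (hfin : Finite W.sha) :
    shaAn W = W.shaOrder := by
  obtain ⟨L, hL⟩ := exists_isSplitMultPAdicLFunctionOf hsp hf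
  obtain ⟨Dq⟩ := (nonempty_tateParameterData_iff_holds (W := W) (p := 2)).mpr hsp
  have h2 := (h Dq f hf L hL).2 hfin ϖ hϖ
  exact (shaAn_eq_shaOrder_iff_of_rankZero W hr han hf ϖ hϖ).mpr
    ((twoAdicLeadingTermSplit_iff_of_rankZero W hGS hr hf hL Dq D ϖ).mp h2)

omit [W.IsGloballyMinimal] in
/-- **`#Ш = #Ш_an ⟹ TwoAdicBSDSplitMult` in rank `0`, given Greenberg–Stevens at `2`**, for EVERY
height datum. [cite: MazurTateTeitelbaum1986Invent, §II.10] -/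
theorem twoAdicBSDSplitMult_of_rankZero_of_shaAn_eq (hGS : greenberg_stevens (W := W) (p := 2))
    (hr : W.mordellWeilRank = 0) (han : W.analyticRank = 0)
    (hBSD : Finite W.sha → shaAn W = W.shaOrder) (D : PAdicHeightData W 2) :
    TwoAdicBSDSplitMult W D := by
  intro _ _ Dq N _ f hf L hL
  refine ⟨?_, fun hfin ϖ hϖ => ?_⟩
  · rw [hr, Nat.cast_zero, zero_add]
    exact order_eq_one_of_greenbergStevens_of_analyticRank_eq_zero W hGS han hf hL Dq
  · exact (twoAdicLeadingTermSplit_iff_of_rankZero W hGS hr hf hL Dq D ϖ).mpr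
      ((shaAn_eq_shaOrder_iff_of_rankZero W hr han hf ϖ hϖ).mp (hBSD hfin))

/-- **CALIBRATION (rank `0`, split multiplicative `2`), given Greenberg–Stevens at `2`:
`TwoAdicBSDSplitMult W D ⟺ (Ш finite ⇒ #Ш_an = #Ш)`**, for every height datum `D` — i.e. on the
`r_an = 0` split-at-`2` rows the E1 exceptional-zero target is the classical formula plus the
memo-proved `greenberg_stevens W 2`, nothing more. [cite: MazurTateTeitelbaum1986Invent, §II.10]
[cite: Disegni2020, Thm. 4 and §3.2.1] -/
theorem twoAdicBSDSplitMult_iff_of_rankZero (hGS : greenberg_stevens (W := W) (p := 2))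
    (hsp : W.HasSplitMultiplicativeReductionAtPrime 2) (hr : W.mordellWeilRank = 0)
    (han : W.analyticRank = 0) {N : ℕ} [NeZero N] {f : CuspForm (Gamma0 N) 2}
    (hf : IsNewformOf W f) (ϖ : ℚ) (hϖ : (ϖ : ℝ) * W.realPeriodRat = plusPeriod f)
    (D : PAdicHeightData W 2) :
    TwoAdicBSDSplitMult W D ↔ (Finite W.sha → shaAn W = W.shaOrder) :=
  ⟨fun h hfin =>
      shaAn_eq_shaOrder_of_twoAdicBSDSplitMult_of_rankZero W hGS hsp hr han hf ϖ hϖ h hfin,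
    fun h => twoAdicBSDSplitMult_of_rankZero_of_shaAn_eq W hGS hr han h D⟩

/-- With Gross–Zagier–Kolyvagin (`hGZK`): on an `r_an = 0` row with split multiplicative `2`, GIVEN
`greenberg_stevens W 2`, `TwoAdicBSDSplitMult W D ⟺ #Ш_an = #Ш`. [folklore] -/
theorem twoAdicBSDSplitMult_iff_shaAn_eq_of_analyticRank_eq_zero
    (hGS : greenberg_stevens (W := W) (p := 2))
    (hGZK : rank_eq_analyticRank_of_analyticRank_le_one)
    (hsp : W.HasSplitMultiplicativeReductionAtPrime 2) (han : W.analyticRank = 0) {N : ℕ}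
    [NeZero N] {f : CuspForm (Gamma0 N) 2} (hf : IsNewformOf W f) (ϖ : ℚ)
    (hϖ : (ϖ : ℝ) * W.realPeriodRat = plusPeriod f) (D : PAdicHeightData W 2) :
    TwoAdicBSDSplitMult W D ↔ shaAn W = W.shaOrder := by
  have hle : W.analyticRank ≤ 1 := by rw [han]; exact zero_le_one
  have hr : W.mordellWeilRank = 0 := by rw [(hGZK W hle).1, han]
  have hfin : Finite W.sha := (hGZK W hle).2
  rw [twoAdicBSDSplitMult_iff_of_rankZero W hGS hsp hr han hf ϖ hϖ D]
  exact ⟨fun h => h hfin, fun h _ => h⟩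

/-! ## §5 (appended) The split doors fed by BOTH memo-proved binders -/

/-- **α-sp END-STATE per pair from the two memo-proved binders (PROVED):** `BSDp W 2` ⟸ PRINT
{`h514`, A236 `h41`, modularity, GZK} + `KatoMultiplicativeDivisibilityRat W 2` (PROOF-MULT) +
`greenberg_stevens W 2` (PROOF-GS2) + the 5.14 data + `hper₀` + `hlow`. On this road the ONLY
per-pair inputs left are the period datum `hper₀` and the lower half `hlow`.
[cite: GreenbergLNM1716, Prop. 5.14 (p. 121) and §4 pp. 112–113] [cite: Miller2011LMS, Def. 1.1 and §1] -/
theorem bsdp_two_split_of_prop514_of_lowerBound_of_multRat_of_greenbergStevens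
    (hKato : KatoMultiplicativeDivisibilityRat W 2)
    (hGS : greenberg_stevens (W := W) (p := 2))
    (h514 : prop514_isTorsion_mu_eq_zero_two)
    (h41 : thm41Analogue_charValue_rankZero_split_baseChange_anyPrime)
    (hmod : nonempty_modularParametrizationData)
    (hGZK : rank_eq_analyticRank_of_analyticRank_le_one)
    (hper₀ : ∀ [NeZero (W.conductorNorm ℤ)] (f : CuspForm (Gamma0 (W.conductorNorm ℤ)) 2),
      IsNewformOf W f → ∀ ϖ : ℚ, (ϖ : ℝ) * W.realPeriodRat = plusPeriod f → 0 ≤ padicValRat 2 ϖ)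
    (hr : W.analyticRank = 0) (hmult : Mult W 2) (hsp : W.HasSplitMultiplicativeReductionAtPrime 2)
    {x y : ℚ} (hP : W.toAffine.Equation x y) (h2 : 2 * y + W.a₁ * x + W.a₃ = 0)
    (hΦ : (TwoTorsionRamifiedAtTwo x ∧ ¬ TwoTorsionOdd W x) ∨
      (TwoTorsionOdd W x ∧ ¬ TwoTorsionRamifiedAtTwo x))
    (hlow : MissingLowerBoundAt W 2) : BSDp W 2 :=
  bsdp_two_split_of_prop514_of_lowerBound_of_multRat W hKato h514 h41 hmod hGZK
    (kappaOne_binder_of_greenbergStevens W hGS hr) hper₀ hr hmult hsp hP h2 hΦ hlow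

/-- **O1-A-sp END-STATE per pair from the two memo-proved binders and a `μ = 0` certificate
(PROVED):** `BSDp W 2` ⟸ PRINT {A236 `h41`, modularity, GZK} + `KatoMultiplicativeDivisibilityRat W 2`
+ `greenberg_stevens W 2` + `hμ` + `hper₀` + `hlow`.
[cite: GreenbergLNM1716, §4 pp. 112–113] [cite: Miller2011LMS, Def. 1.1 and §1] -/
theorem bsdp_two_split_of_mu_eq_zero_of_lowerBound_of_multRat_of_greenbergStevens
    (hKato : KatoMultiplicativeDivisibilityRat W 2)
    (hGS : greenberg_stevens (W := W) (p := 2))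
    (h41 : thm41Analogue_charValue_rankZero_split_baseChange_anyPrime)
    (hmod : nonempty_modularParametrizationData)
    (hGZK : rank_eq_analyticRank_of_analyticRank_le_one)
    (hμ : ∀ (κ : ZpExtension ℚ 2) (γ : Field.absoluteGaloisGroup ℚ), κ.IsCyclotomic →
      κ.IsTopGenerator γ → IsCyclotomicVariable 2 γ → ∀ D : W.SelmerDualData κ γ, D.mu = 0)
    (hper₀ : ∀ [NeZero (W.conductorNorm ℤ)] (f : CuspForm (Gamma0 (W.conductorNorm ℤ)) 2),
      IsNewformOf W f → ∀ ϖ : ℚ, (ϖ : ℝ) * W.realPeriodRat = plusPeriod f → 0 ≤ padicValRat 2 ϖ)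
    (hr : W.analyticRank = 0) (hmult : Mult W 2) (hsp : W.HasSplitMultiplicativeReductionAtPrime 2)
    (hlow : MissingLowerBoundAt W 2) : BSDp W 2 :=
  bsdp_two_split_of_mu_eq_zero_of_lowerBound_of_multRat W hKato h41 hmod hGZK hμ
    (kappaOne_binder_of_greenbergStevens W hGS hr) hper₀ hr hmult hsp hlow

end Summit.BirchSwinnertonDyer.Rank1Residual.X5.O1

end
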